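import Summits.BirchSwinnertonDyer.Rank1Residual.GaloisImage.ContinuousH1CoefficientTransport
import Summits.BirchSwinnertonDyer.Rank1Residual.GaloisImage.KolyvaginDerivativeAlgebra
import Literature.NumberTheory.EllipticCurves.Kato2004.EulerSystemValues
import HarnessLib

/-!
# Kato's dual-exponential value datum commutes with Kolyvagin's derivative operators
# (T-PORT-1 §3 (P-KIM), brick K-iii = PK-1 `KatoZetaValueEquivariance`; cell `b2b-bsdres`, team
# n1011, seat p02 gen 11; TOOL)

HONEST FRAMING (cell `b2b-bsdres`, run/shared/lean/b2b/bsd-rank1-residual/, verbatim in every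
file): the goal of the cell is to DELETE the COMBINATION-SHAPED residual classes of the
Birch–Swinnerton-Dyer formula for ALL analytic-rank `≤ 1` elliptic curves over `ℚ` — "full BSD
formula for every rank `≤ 1` curve in class `C`" assembled STRICTLY from published theorems — so
that the rank-`≤ 1` remainder becomes exactly the CONSTRUCTION-SHAPED classes, which are TYPED
(missing-input `Prop`s), NOT attempted. This is not "finishing BSD". Team n1011 (N10 / N11):
research route on the CONSTRUCTION-SHAPED class X4 / §I N11 (route-1 PORT of record, DICT3₁);
TOOL theorems only (no definition, no named fact); the Kato fact `ZetaBody` enters as a displayed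
HYPOTHESIS `hbody`, never asserted; nothing is booked; no mark / label / flag text moves.

## What this file proves

(S2) of the printed chain ([Kim–Nakamura 2018] §3.2: "the derivative operator `D_n ∈ ℤ[Gal]`
commutes with `loc_p`, `exp*` and `⟨ω, ·⟩`") in the tree's currency: `ZetaBody`'s clause (C3a)
(`Λ_{k,r}(σ · y) = (1 ⊗ σ_{χ_m(σ)}) Λ_{k,r}(y)`) ITERATED over the derivative operators
`D = ∏_{ℓ ∈ s} Σ_{j < N_ℓ} j·σ_ℓ^j` in which THEOREM A of row T-DER states Kolyvagin's derivative
(`Derivative.existsUnique_res_eq_deriv`, `Finset.noncommProd` of `conjMap`-powers):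

* `addMonoidHom_apply_noncommProd_deriv` — ring-free core: an additive map `Λ : M →+ M′` with
  `Λ (F_ℓ v) = F′_ℓ (Λ v)` carries `∏ Σ j F_ℓ^j` (over `R`) to `∏ Σ j F′_ℓ^j` (over `S`)
  (the tree's `CoeffTransport.addMonoidHom_apply_noncommProd_apply` ∘ `…_apply_deriv_apply`);
* **`zetaBody_apply_deriv`** — under `hbody : ZetaBody W p f ι κ Λ c d a A z x`, for every level
  `(k, r)`, elements `σ_ℓ ∈ Γ_ℚ`, lengths `N_ℓ` and every `y ∈ H¹(ℚ(μ_{m(k,r)}), T_pW)`: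
  `Λ_{k,r} (D y) = D′ (Λ_{k,r} y)` with `D′ = ∏ Σ j (1 ⊗ σ_{χ_m(σ_ℓ)})^j` on `ℚ_p ⊗ ℚ(ζ_m)`;
* `addMonoidHom_apply_noncommProd_norm`, `zetaBody_apply_norm` — the same for the NORM-type
  operators `∏ Σ_{j<N_ℓ} σ_ℓ^j` (Kolyvagin's `N_ℓ`);
* **`zetaBody_apply_deriv_zeta`** — with (C4): `Λ_{k,r} (D z_{k,r}) = D′ (1 ⊗ x_{k,r})`;
* `sigma_comm_apply`, `commute_sigma`, `commute_tensorMap_sigma`, `pairwise_commute_fieldDeriv`,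
  `pairwise_commute_tensorDeriv` — the operators `σ_b` of `ℚ(ζ_m)` and `1 ⊗ σ_b` of
  `ℚ_p ⊗ ℚ(ζ_m)` (hence their derivative operators) pairwise commute (`Gal(ℚ(ζ_m)/ℚ)` abelian), so
  consumers supply only THEOREM A's `comm` for the `conjMap` operators;
* `includeRight_apply_deriv` — `D′ (1 ⊗ t) = 1 ⊗ (D^{field} t)` with `D^{field}` the same
  operator as a `ℚ`-linear endomorphism of `ℚ(ζ_m)` (`σ_ℓ` acting through `sigma`);
* **`zetaBody_apply_deriv_zeta_eq_tmul`** (★) — `Λ_{k,r} (D z_{k,r}) = 1 ⊗ (D^{field} x_{k,r})`, the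
  form the PORT bricks PK-3 / PK-4 / PK-6 consume (r1, K-iii ★2).

`p` is generic (`[Fact p.Prime]`, the `ZetaBody` binders verbatim); the PORT instantiates `p = 3`.
Pure module algebra — no lattice / index / onto statement at `ℚ(μ_m) ⊗ ℚ₃`.

References (context): C.-H. Kim, K. Nakamura, arXiv:1808.07726 §3.2; K. Rubin, *Euler Systems*
(2000) Def. 4.4.1; K. Kato, Astérisque 295 (2004) §9.4, Thm. 9.7.
-/

noncomputable section

open CategoryTheory
open scoped BigOperators NumberField TensorProduct
open Field IsDedekindDomain CongruenceSubgroup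

namespace Summit.BirchSwinnertonDyer.Rank1Residual.GaloisImage.ZetaValue

open Literature.NumberTheory.GaloisRepresentations Literature.NumberTheory.EllipticCurves
  Literature.NumberTheory.EllipticCurves.ModularForms
  Literature.NumberTheory.EllipticCurves.Kato2004
  Literature.NumberTheory.EllipticCurves.Kato2004.EulerSystemValues Rat.HeightOneSpectrum

/-! ### §1. Ring-free core -/

/-- An additive map intertwining two commuting families `F_ℓ` (over `R`) and `F′_ℓ` (over `S`)
carries the derivative operator `∏_{ℓ ∈ s} Σ_{j < N_ℓ} j F_ℓ^j` to `∏_{ℓ ∈ s} Σ_{j < N_ℓ} j F′_ℓ^j`.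
[cite: Rubin2000, Def. 4.4.1] -/
theorem addMonoidHom_apply_noncommProd_deriv {R : Type*} [Ring R] {S : Type*} [Ring S]
    {M : Type*} [AddCommGroup M] [Module R M] {M' : Type*} [AddCommGroup M'] [Module S M']
    {ι : Type*} (Λ : M →+ M') (F : ι → Module.End R M) (F' : ι → Module.End S M')
    (N : ι → ℕ) (s : Finset ι) (h : ∀ ℓ ∈ s, ∀ v, Λ (F ℓ v) = F' ℓ (Λ v)) (comm) (comm') (v : M) :
    Λ (s.noncommProd (fun ℓ => ∑ j ∈ Finset.range (N ℓ), (j : Module.End R M) * F ℓ ^ j) comm v) =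
      s.noncommProd (fun ℓ => ∑ j ∈ Finset.range (N ℓ), (j : Module.End S M') * F' ℓ ^ j) comm'
        (Λ v) :=
  CoeffTransport.addMonoidHom_apply_noncommProd_apply Λ _ _ s comm comm'
    (fun ℓ hℓ w => CoeffTransport.addMonoidHom_apply_deriv_apply Λ (h ℓ hℓ) (N ℓ) w) v

/-- The same for the NORM-type operators `∏_{ℓ ∈ s} Σ_{j < N_ℓ} F_ℓ^j` (no factor `j`; Kolyvagin's
`N_ℓ = Σ_j σ_ℓ^j`, companion of `D_ℓ` in `(σ_ℓ − 1)D_ℓ = N_ℓ − N_ℓ·1`-type identities).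
[cite: Rubin2000, Def. 4.4.1] -/
theorem addMonoidHom_apply_noncommProd_norm {R : Type*} [Ring R] {S : Type*} [Ring S]
    {M : Type*} [AddCommGroup M] [Module R M] {M' : Type*} [AddCommGroup M'] [Module S M']
    {ι : Type*} (Λ : M →+ M') (F : ι → Module.End R M) (F' : ι → Module.End S M')
    (N : ι → ℕ) (s : Finset ι) (h : ∀ ℓ ∈ s, ∀ v, Λ (F ℓ v) = F' ℓ (Λ v)) (comm) (comm') (v : M) :
    Λ (s.noncommProd (fun ℓ => ∑ j ∈ Finset.range (N ℓ), F ℓ ^ j) comm v) =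
      s.noncommProd (fun ℓ => ∑ j ∈ Finset.range (N ℓ), F' ℓ ^ j) comm' (Λ v) := by
  refine CoeffTransport.addMonoidHom_apply_noncommProd_apply Λ _ _ s comm comm' (fun ℓ hℓ w => ?_) v
  rw [LinearMap.sum_apply, LinearMap.sum_apply, map_sum]
  exact Finset.sum_congr rfl fun i _ => CoeffTransport.addMonoidHom_apply_pow_apply Λ (h ℓ hℓ) i w

/-! ### §2. The operators `σ_b` of `ℚ(ζ_m)` and `1 ⊗ σ_b` of `ℚ_p ⊗ ℚ(ζ_m)` pairwise commute -/

/-- `σ_a(σ_b(w)) = σ_b(σ_a(w))` on `ℚ(ζ_m)` (`Gal(ℚ(ζ_m)/ℚ) ≅ (ℤ/m)ˣ` is abelian; `sigma` is the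
inverse of Mathlib's `autEquivPow`, a group isomorphism). [folklore] -/
theorem sigma_comm_apply (m : ℕ) [NeZero m] (a b : (ZMod m)ˣ) (w : CyclotomicField m ℚ) :
    sigma m a (sigma m b w) = sigma m b (sigma m a w) := by
  have h : sigma m a * sigma m b = sigma m b * sigma m a := by
    unfold sigma
    rw [← map_mul, ← map_mul, mul_comm]
  rw [← AlgEquiv.mul_apply, h, AlgEquiv.mul_apply]

/-- `σ_a σ_b = σ_b σ_a` as `ℚ`-linear endomorphisms of `ℚ(ζ_m)`. [folklore] -/
theorem commute_sigma (m : ℕ) [NeZero m] (a b : (ZMod m)ˣ) :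
    Commute ((sigma m a : CyclotomicField m ℚ →ₐ[ℚ] CyclotomicField m ℚ).toLinearMap)
      ((sigma m b : CyclotomicField m ℚ →ₐ[ℚ] CyclotomicField m ℚ).toLinearMap) := by
  change _ * _ = _ * _
  refine LinearMap.ext fun v => ?_
  simp only [Module.End.mul_apply, AlgHom.toLinearMap_apply]
  exact sigma_comm_apply m a b v

/-- `(1 ⊗ σ_a)(1 ⊗ σ_b) = (1 ⊗ σ_b)(1 ⊗ σ_a)` on `ℚ_p ⊗ ℚ(ζ_m)`. [folklore] -/
theorem commute_tensorMap_sigma (p m : ℕ) [Fact p.Prime] [NeZero m] (a b : (ZMod m)ˣ) :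
    Commute
      ((Algebra.TensorProduct.map (AlgHom.id ℚ ℚ_[p])
        (sigma m a : CyclotomicField m ℚ →ₐ[ℚ] CyclotomicField m ℚ)).toLinearMap)
      ((Algebra.TensorProduct.map (AlgHom.id ℚ ℚ_[p])
        (sigma m b : CyclotomicField m ℚ →ₐ[ℚ] CyclotomicField m ℚ)).toLinearMap) := by
  change _ * _ = _ * _
  refine TensorProduct.ext' fun u w => ?_
  simp only [Module.End.mul_apply, AlgHom.toLinearMap_apply, Algebra.TensorProduct.map_tmul,
    AlgHom.coe_id, id_eq]
  congr 1
  exact sigma_comm_apply m a b w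

/-- The field-level derivative operators `Σ_{j<N_a} j σ_{b_a}^j` pairwise commute. [folklore] -/
theorem pairwise_commute_fieldDeriv (m : ℕ) [NeZero m] {ι' : Type*} (b : ι' → (ZMod m)ˣ)
    (Nℓ : ι' → ℕ) (s : Finset ι') :
    (s : Set ι').Pairwise fun i j => Commute
      (∑ n ∈ Finset.range (Nℓ i), (n : Module.End ℚ (CyclotomicField m ℚ)) *
        (sigma m (b i) : CyclotomicField m ℚ →ₐ[ℚ] CyclotomicField m ℚ).toLinearMap ^ n)
      (∑ n ∈ Finset.range (Nℓ j), (n : Module.End ℚ (CyclotomicField m ℚ)) *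
        (sigma m (b j) : CyclotomicField m ℚ →ₐ[ℚ] CyclotomicField m ℚ).toLinearMap ^ n) :=
  fun i _ j _ _ => Derivative.commute_deriv_deriv
    (σ := fun i => (sigma m (b i) : CyclotomicField m ℚ →ₐ[ℚ] CyclotomicField m ℚ).toLinearMap)
    (fun i j => commute_sigma m (b i) (b j)) Nℓ i j

/-- The tensor-level derivative operators `Σ_{j<N_a} j (1 ⊗ σ_{b_a})^j` pairwise commute.
[folklore] -/
theorem pairwise_commute_tensorDeriv (p m : ℕ) [Fact p.Prime] [NeZero m] {ι' : Type*}
    (b : ι' → (ZMod m)ˣ) (Nℓ : ι' → ℕ) (s : Finset ι') :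
    (s : Set ι').Pairwise fun i j => Commute
      (∑ n ∈ Finset.range (Nℓ i), (n : Module.End ℚ (ℚ_[p] ⊗[ℚ] CyclotomicField m ℚ)) *
        (Algebra.TensorProduct.map (AlgHom.id ℚ ℚ_[p])
          (sigma m (b i) : CyclotomicField m ℚ →ₐ[ℚ] CyclotomicField m ℚ)).toLinearMap ^ n)
      (∑ n ∈ Finset.range (Nℓ j), (n : Module.End ℚ (ℚ_[p] ⊗[ℚ] CyclotomicField m ℚ)) *
        (Algebra.TensorProduct.map (AlgHom.id ℚ ℚ_[p])
          (sigma m (b j) : CyclotomicField m ℚ →ₐ[ℚ] CyclotomicField m ℚ)).toLinearMap ^ n) :=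
  fun i _ j _ _ => Derivative.commute_deriv_deriv
    (σ := fun i => (Algebra.TensorProduct.map (AlgHom.id ℚ ℚ_[p])
      (sigma m (b i) : CyclotomicField m ℚ →ₐ[ℚ] CyclotomicField m ℚ)).toLinearMap)
    (fun i j => commute_tensorMap_sigma p m (b i) (b j)) Nℓ i j

/-! ### §3. Kato's value datum under `ZetaBody` -/

section Zeta

variable (W : WeierstrassCurve ℚ) [W.IsElliptic] (p : ℕ) [Fact p.Prime]
  [ContinuousSMul ℤ_[p] (W.tateModule p)] [Module.Free ℤ_[p] (W.tateModule p)]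
  [Module.Finite ℤ_[p] (W.tateModule p)] {N : ℕ} (f : CuspForm (Gamma0 N) 2)
  (ι : (m : ℕ) → (CyclotomicField m ℚ →+* ℂ)) (κ : ℝ)
  (Λ : ∀ (k : ℕ) (r : Finset (HeightOneSpectrum (𝓞 ℚ))),
    H1 (tateRep W p) (cycSubgroup p k r) →ₗ[ℤ_[p]] ℚ_[p] ⊗[ℚ] CyclotomicField (cycLevel p k r) ℚ)
  (c d a : ℤ) (A : ℕ)
  (z : ∀ (k : ℕ) (r : (cyclotomicLevelsRat p (badPlaces c d A N)).Ideals),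
    H1 (tateRep W p) ((cyclotomicLevelsRat p (badPlaces c d A N)).level k r.1))
  (x : ∀ (k : ℕ) (r : (cyclotomicLevelsRat p (badPlaces c d A N)).Ideals),
    CyclotomicField (cycLevel p k r.1) ℚ)

/-- **(C3a) iterated: Kato's value datum commutes with the derivative operators.** Under
`hbody : ZetaBody …`, for every level `(k, r)`, every family `σ_ℓ ∈ Γ_ℚ` with lengths `N_ℓ` over a
finite index set `s` and every `y ∈ H¹(ℚ(μ_{m(k,r)}), T_pW)`:
`Λ_{k,r} ((∏_{ℓ∈s} Σ_{j<N_ℓ} j·σ_ℓ^j) y) = (∏_{ℓ∈s} Σ_{j<N_ℓ} j·(1 ⊗ σ_{χ_m(σ_ℓ)})^j) (Λ_{k,r} y)`,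
the `σ_ℓ` acting on `H¹` through `conjMap` and on `ℚ_p ⊗ ℚ(ζ_m)` through `1 ⊗ sigma`.
[cite: Kato2004Asterisque, §9.4 (p. 188) and Thm. 9.7 (p. 189)] -/
theorem zetaBody_apply_deriv (hbody : ZetaBody W p f ι κ Λ c d a A z x) (k : ℕ)
    (r : Finset (HeightOneSpectrum (𝓞 ℚ)))
    {ι' : Type*} (σ : ι' → absoluteGaloisGroup ℚ) (Nℓ : ι' → ℕ) (s : Finset ι') (comm) (comm')
    (y : H1 (tateRep W p) (cycSubgroup p k r)) :
    Λ k r (s.noncommProd (fun ℓ => ∑ j ∈ Finset.range (Nℓ ℓ),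
        (j : Module.End ℤ_[p] (H1 (tateRep W p) (cycSubgroup p k r))) *
          (conjMap (tateRep W p).toTopRep (cycSubgroup p k r) (σ ℓ) 1).hom.toLinearMap ^ j) comm y) =
      s.noncommProd (fun ℓ => ∑ j ∈ Finset.range (Nℓ ℓ),
        (j : Module.End ℚ (ℚ_[p] ⊗[ℚ] CyclotomicField (cycLevel p k r) ℚ)) *
          (Algebra.TensorProduct.map (AlgHom.id ℚ ℚ_[p])
            (sigma (cycLevel p k r) (modNCyclotomicCharacter ℚ (cycLevel p k r) (σ ℓ)) :
              CyclotomicField (cycLevel p k r) ℚ →ₐ[ℚ] CyclotomicField (cycLevel p k r) ℚ)).toLinearMap ^ j)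
        comm' (Λ k r y) := by
  obtain ⟨-, -, h3a, -, -, -⟩ := hbody
  exact addMonoidHom_apply_noncommProd_deriv (Λ k r).toAddMonoidHom _ _ Nℓ s
    (fun ℓ _ v => h3a k r (σ ℓ) v) comm comm' y

/-- **(C3a) iterated, norm-type operators**: `Λ_{k,r} ((∏_{ℓ∈s} Σ_{j<N_ℓ} σ_ℓ^j) y) =
(∏_{ℓ∈s} Σ_{j<N_ℓ} (1 ⊗ σ_{χ_m(σ_ℓ)})^j) (Λ_{k,r} y)`. [cite: Kato2004Asterisque, §9.4 (p. 188)] -/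
theorem zetaBody_apply_norm (hbody : ZetaBody W p f ι κ Λ c d a A z x) (k : ℕ)
    (r : Finset (HeightOneSpectrum (𝓞 ℚ)))
    {ι' : Type*} (σ : ι' → absoluteGaloisGroup ℚ) (Nℓ : ι' → ℕ) (s : Finset ι') (comm) (comm')
    (y : H1 (tateRep W p) (cycSubgroup p k r)) :
    Λ k r (s.noncommProd (fun ℓ => ∑ j ∈ Finset.range (Nℓ ℓ),
          (conjMap (tateRep W p).toTopRep (cycSubgroup p k r) (σ ℓ) 1).hom.toLinearMap ^ j) comm y) =
      s.noncommProd (fun ℓ => ∑ j ∈ Finset.range (Nℓ ℓ),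
          (Algebra.TensorProduct.map (AlgHom.id ℚ ℚ_[p])
            (sigma (cycLevel p k r) (modNCyclotomicCharacter ℚ (cycLevel p k r) (σ ℓ)) :
              CyclotomicField (cycLevel p k r) ℚ →ₐ[ℚ] CyclotomicField (cycLevel p k r) ℚ)).toLinearMap ^ j)
        comm' (Λ k r y) := by
  obtain ⟨-, -, h3a, -, -, -⟩ := hbody
  exact addMonoidHom_apply_noncommProd_norm (Λ k r).toAddMonoidHom _ _ Nℓ s
    (fun ℓ _ v => h3a k r (σ ℓ) v) comm comm' y

/-- **With (C4): the derivative of Kato's zeta element is valued at the derivative of `1 ⊗ x`.**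
`Λ_{k,r} (D z_{k,r}) = D′ (1 ⊗ x_{k,r})` for every tame level `(k, r)` of the Euler system.
[cite: Kato2004Asterisque, Thm. 9.7 (p. 189)] -/
theorem zetaBody_apply_deriv_zeta (hbody : ZetaBody W p f ι κ Λ c d a A z x) (k : ℕ)
    (r : (cyclotomicLevelsRat p (badPlaces c d A N)).Ideals)
    {ι' : Type*} (σ : ι' → absoluteGaloisGroup ℚ) (Nℓ : ι' → ℕ) (s : Finset ι') (comm) (comm') :
    Λ k r.1 (s.noncommProd (fun ℓ => ∑ j ∈ Finset.range (Nℓ ℓ),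
        (j : Module.End ℤ_[p] (H1 (tateRep W p) (cycSubgroup p k r.1))) *
          (conjMap (tateRep W p).toTopRep (cycSubgroup p k r.1) (σ ℓ) 1).hom.toLinearMap ^ j) comm
            (z k r)) =
      s.noncommProd (fun ℓ => ∑ j ∈ Finset.range (Nℓ ℓ),
        (j : Module.End ℚ (ℚ_[p] ⊗[ℚ] CyclotomicField (cycLevel p k r.1) ℚ)) *
          (Algebra.TensorProduct.map (AlgHom.id ℚ ℚ_[p])
            (sigma (cycLevel p k r.1) (modNCyclotomicCharacter ℚ (cycLevel p k r.1) (σ ℓ)) :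
              CyclotomicField (cycLevel p k r.1) ℚ →ₐ[ℚ] CyclotomicField (cycLevel p k r.1) ℚ)).toLinearMap ^ j)
        comm' ((1 : ℚ_[p]) ⊗ₜ[ℚ] x k r) := by
  have h4 : Λ k r.1 (z k r) = (1 : ℚ_[p]) ⊗ₜ[ℚ] x k r := by
    obtain ⟨-, -, -, -, h4, -⟩ := hbody
    exact h4 k r
  rw [← h4]
  exact zetaBody_apply_deriv W p f ι κ Λ c d a A z x hbody k r.1 σ Nℓ s comm comm' (z k r)

/-- The inclusion `x ↦ 1 ⊗ x` of `ℚ(ζ_m)` into `ℚ_p ⊗ ℚ(ζ_m)` carries the field-level derivative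
operator `∏ Σ j σ_ℓ^j` (the `σ_ℓ` acting through `sigma`) to the tensor-level one (`1 ⊗ sigma`).
[folklore] -/
theorem includeRight_apply_deriv (k : ℕ) (r : Finset (HeightOneSpectrum (𝓞 ℚ)))
    {ι' : Type*} (σ : ι' → absoluteGaloisGroup ℚ) (Nℓ : ι' → ℕ) (s : Finset ι') (comm') (comm'')
    (t : CyclotomicField (cycLevel p k r) ℚ) :
    s.noncommProd (fun ℓ => ∑ j ∈ Finset.range (Nℓ ℓ),
        (j : Module.End ℚ (ℚ_[p] ⊗[ℚ] CyclotomicField (cycLevel p k r) ℚ)) *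
          (Algebra.TensorProduct.map (AlgHom.id ℚ ℚ_[p])
            (sigma (cycLevel p k r) (modNCyclotomicCharacter ℚ (cycLevel p k r) (σ ℓ)) :
              CyclotomicField (cycLevel p k r) ℚ →ₐ[ℚ] CyclotomicField (cycLevel p k r) ℚ)).toLinearMap ^ j)
        comm' ((1 : ℚ_[p]) ⊗ₜ[ℚ] t) =
      (1 : ℚ_[p]) ⊗ₜ[ℚ] (s.noncommProd (fun ℓ => ∑ j ∈ Finset.range (Nℓ ℓ),
        (j : Module.End ℚ (CyclotomicField (cycLevel p k r) ℚ)) *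
          (sigma (cycLevel p k r) (modNCyclotomicCharacter ℚ (cycLevel p k r) (σ ℓ)) :
              CyclotomicField (cycLevel p k r) ℚ →ₐ[ℚ]
                CyclotomicField (cycLevel p k r) ℚ).toLinearMap ^ j) comm'' t) := by
  symm
  exact addMonoidHom_apply_noncommProd_deriv
    ((TensorProduct.mk ℚ ℚ_[p] (CyclotomicField (cycLevel p k r) ℚ) (1 : ℚ_[p])).toAddMonoidHom)
    _ _ Nℓ s (fun ℓ _ v => by simp) comm'' comm' t

/-- **★ The derivative of Kato's zeta element, valued in `ℚ(ζ_m)`:**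
`Λ_{k,r} (D z_{k,r}) = 1 ⊗ (D^{field} x_{k,r})`, `D^{field} = ∏_{ℓ∈s} Σ_{j<N_ℓ} j·σ_{χ_m(σ_ℓ)}^j` the
same operator as a `ℚ`-linear endomorphism of `ℚ(ζ_{m(k,r)})` — the input the PORT bricks PK-3 /
PK-4 consume (r1 ROUTE-1 §53, K-iii ★2). [cite: Kato2004Asterisque, Thm. 9.7 (p. 189)] -/
theorem zetaBody_apply_deriv_zeta_eq_tmul (hbody : ZetaBody W p f ι κ Λ c d a A z x) (k : ℕ)
    (r : (cyclotomicLevelsRat p (badPlaces c d A N)).Ideals)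
    {ι' : Type*} (σ : ι' → absoluteGaloisGroup ℚ) (Nℓ : ι' → ℕ) (s : Finset ι') (comm) :
    Λ k r.1 (s.noncommProd (fun ℓ => ∑ j ∈ Finset.range (Nℓ ℓ),
        (j : Module.End ℤ_[p] (H1 (tateRep W p) (cycSubgroup p k r.1))) *
          (conjMap (tateRep W p).toTopRep (cycSubgroup p k r.1) (σ ℓ) 1).hom.toLinearMap ^ j) comm
            (z k r)) =
      (1 : ℚ_[p]) ⊗ₜ[ℚ] (s.noncommProd (fun ℓ => ∑ j ∈ Finset.range (Nℓ ℓ),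
        (j : Module.End ℚ (CyclotomicField (cycLevel p k r.1) ℚ)) *
          (sigma (cycLevel p k r.1) (modNCyclotomicCharacter ℚ (cycLevel p k r.1) (σ ℓ)) :
              CyclotomicField (cycLevel p k r.1) ℚ →ₐ[ℚ]
                CyclotomicField (cycLevel p k r.1) ℚ).toLinearMap ^ j)
        (pairwise_commute_fieldDeriv (cycLevel p k r.1)
          (fun ℓ => modNCyclotomicCharacter ℚ (cycLevel p k r.1) (σ ℓ)) Nℓ s) (x k r)) := by
  have comm' : ((s : Set ι').Pairwise fun a b => Commute
      (∑ j ∈ Finset.range (Nℓ a),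
        (j : Module.End ℚ (ℚ_[p] ⊗[ℚ] CyclotomicField (cycLevel p k r.1) ℚ)) *
          (Algebra.TensorProduct.map (AlgHom.id ℚ ℚ_[p])
            (sigma (cycLevel p k r.1) (modNCyclotomicCharacter ℚ (cycLevel p k r.1) (σ a)) :
              CyclotomicField (cycLevel p k r.1) ℚ →ₐ[ℚ] CyclotomicField (cycLevel p k r.1) ℚ)).toLinearMap ^ j)
      (∑ j ∈ Finset.range (Nℓ b),
        (j : Module.End ℚ (ℚ_[p] ⊗[ℚ] CyclotomicField (cycLevel p k r.1) ℚ)) *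
          (Algebra.TensorProduct.map (AlgHom.id ℚ ℚ_[p])
            (sigma (cycLevel p k r.1) (modNCyclotomicCharacter ℚ (cycLevel p k r.1) (σ b)) :
              CyclotomicField (cycLevel p k r.1) ℚ →ₐ[ℚ] CyclotomicField (cycLevel p k r.1) ℚ)).toLinearMap ^ j)) :=
    pairwise_commute_tensorDeriv p (cycLevel p k r.1)
      (fun ℓ => modNCyclotomicCharacter ℚ (cycLevel p k r.1) (σ ℓ)) Nℓ s
  rw [zetaBody_apply_deriv_zeta W p f ι κ Λ c d a A z x hbody k r σ Nℓ s comm comm',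
    includeRight_apply_deriv]

end Zeta

end Summit.BirchSwinnertonDyer.Rank1Residual.GaloisImage.ZetaValue

end
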